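import Summits.HodgeConjecture.HodgeConjecture.Theorems.MarkmanPartnerTransportIsometrySpannedThirdOfLefschetzStandard

/-!
# Route MarkmanPartnerTransport · graph classes from kappa classes for ARBITRARY endomorphisms of `H²(X)`, and
# kappa classes of cycle-induced endomorphisms (toolkit for the cycle-induced sector of `K3Sq2TypeHodge`)

First half of the `X`-side analogue of the K3-square rung F4 (`SquareOfGenerator`) for crux #5
`LowPicardRealMultiplication` of route MarkmanPartnerTransport (consumer:
`Theorems/MarkmanPartnerTransportK3Sq2TypeHodgeOfCycleInducedGenerators`). Gen 10's identity
`κ_g = pr_{1*}(Q_X ∪ Z)` (`kappaClass_eq_complexGysin_qInvClass_cup`, for EVERY class `Z` with `g = [Z]_*`) and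
gen 10's cubic-form computation `graphClasses_of_kappaClasses` (there for bijective isometries `g`) are run
for ARBITRARY `ℂ`-linear endomorphisms `g`:

* `sum_gramInv_k3HilbertForm_single_eq` — `Σᵢ (G⁻¹)ᵢⱼ q(eᵢ, v) = vⱼ` (inverse Gram contracts `q` to
  coordinates; `G` symmetric, `det G = 2`);
* `exists_graphClass_of_kappaClass` — for ANY `g` with `κ_g = Σ (G⁻¹)ᵢⱼ · φ⁻¹eᵢ ∪ g φ⁻¹eⱼ` algebraic, `κ_g` is a
  graph class for `g`: `(κ_g ∪ y) ∪ w = (t·q(y,w) + q(gy,w) + q(gw,y))·P` with `t = Σ (G⁻¹)ᵢⱼ q(eᵢ, g eⱼ)`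
  (`= tr g`) — the contraction `Σ (G⁻¹)ᵢⱼ q(eᵢ,y) q(g eⱼ,w) = q(g y, w)` by LINEARITY of `g` (no bijectivity,
  no isometry);
* `kappaClass_mem_algebraicClasses_of_corrAction` — `κ_g ∈ A²(X)` for `g = [Z]_*`, `Z ∈ A⁴(X × X)`, granted F-QX
  (`QInvAlgebraic`, ⟸ Charles–Markman + Verbitsky–Guan: `qInvAlgebraic_of_charlesMarkman`) and the
  multiplicativity of algebraic classes (a tree theorem).

No definition, no sorry; prover seat hodge-nonav-19652-p1 (gen 7), `--supports stmt-HodgeConjecture-19653`.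
Nothing here proves HC or any item.

References: K. O'Grady, Comm. Contemp. Math. 10 (2008) §2; E. Markman, Compos. Math. 160 (2024) Thm. 1.1;
F. Charles–E. Markman, Compos. Math. 149 (2013) Thm. 1.1; C. Voisin, *Hodge Theory II*, Prop. 9.20, Thm. 10.17.
-/
noncomputable section

set_option linter.dupNamespace false

open Module CategoryTheory MonoidalCategory CartesianMonoidalCategory
open Literature.AlgebraicTopology.SingularHomology Literature.Geometry.Kaehler
open Literature.AlgebraicGeometry Literature.AlgebraicGeometry.Motives Literature.AlgebraicGeometry.HodgeTheory
open Literature.AlgebraicGeometry.Hyperkaehler Literature.AlgebraicGeometry.Surfaces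
open Summit.HodgeConjecture.HodgeConjecture.Theorems.NikulinTwinTransport
open Summit.HodgeConjecture.HodgeConjecture.Theorems.MarkmanPartnerTransport.BBFPositivity

namespace Summit.HodgeConjecture.HodgeConjecture.Theorems.MarkmanPartnerTransport.PartnerLattice

/-- `MarkedK3Sq[X, φ, P, z]`: VERBATIM the `let MarkedK3Sq := …` binder of the route declarations of
MarkmanPartnerTransport (clauses (m1)–(m6)). Local notation only. -/
local notation3 (prettyPrint := false) "MarkedK3Sq[" X ", " φ ", " P ", " z "]" =>
  (((IsIntegralClass P ∧ ∀ Q : complexBetti X (2 * 4), IsIntegralClass Q → ∃ n : ℤ, Q = n • P) ∧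
    (∀ c : complexBetti X 2, IsIntegralClass c ↔ ∃ v : K3HilbertIndex → ℤ, φ c = fun i => (v i : ℂ)) ∧
    (∀ a : complexBetti X 2, cupPowTwo a 4 = ((3 : ℂ) * (k3HilbertForm 2 (φ a) (φ a)) ^ 2) • P) ∧
    (IsOfHodgeType 4 X 2 2 0 (LinearEquiv.symm φ z) ∧
      ∀ τ : complexBetti X 2, IsOfHodgeType 4 X 2 2 0 τ → ∃ t : ℂ, τ = t • LinearEquiv.symm φ z) ∧
    (∀ c : complexBetti X 2, IsOfHodgeType 4 X 2 1 1 c ↔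
      (k3HilbertForm 2 (φ c) z = 0 ∧ k3HilbertForm 2 (φ c) (star z) = 0)) ∧
    (k3HilbertForm 2 z z = 0 ∧ 0 < (k3HilbertForm 2 (star z) z).re)))

/-- `Cup3[c, y, w] = (c ∪ y) ∪ w ∈ H⁸` for `c ∈ H⁴`, `y, w ∈ H²`. Local notation only. -/
local notation3 (prettyPrint := false) "Cup3[" c ", " y ", " w "]" =>
  cupProduct (rfl : 2 * 3 + 2 = 2 * 4) (cupProduct (rfl : 2 * 2 + 2 = 2 * 3) c y) w

/-- `Kap[φ, g] = Σ_{ij} (G⁻¹)_{ij} · φ⁻¹eᵢ ∪ g(φ⁻¹eⱼ) ∈ H⁴(X(ℂ); ℂ)`, the kappa class of an endomorphism `g`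
of `H²(X(ℂ); ℂ)`. Local notation only. -/
local notation3 (prettyPrint := false) "Kap[" φ ", " g "]" =>
  (∑ i : K3HilbertIndex, ∑ j : K3HilbertIndex,
    (((k3HilbertGram 2).map (Int.cast : ℤ → ℂ))⁻¹ i j) •
      cupProduct (rfl : 2 + 2 = 2 * 2) ((LinearEquiv.symm φ) (Pi.single i 1))
        (g ((LinearEquiv.symm φ) (Pi.single j 1))))

variable {X : SchemeOver ℂ} {φ : complexBetti X 2 ≃ₗ[ℂ] (K3HilbertIndex → ℂ)} {P : complexBetti X (2 * 4)}
  {z : K3HilbertIndex → ℂ}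

/-! ### The inverse Gram matrix contracts `q` to coordinates -/

/-- **`Σᵢ (G⁻¹)ᵢⱼ q(eᵢ, v) = vⱼ`** for the Beauville–Bogomolov Gram matrix `G` of `K3^{[2]}`-type on `ℂ²³`
(`G` symmetric, `det G = 2`): `q(eᵢ, v) = (Gv)ᵢ` and `(G⁻¹)ᵀ G = 1`. [cite: OGrady2008NumericalK3Square, §2.1 (2.1.2)] -/
theorem sum_gramInv_k3HilbertForm_single_eq (v : K3HilbertIndex → ℂ) (j : K3HilbertIndex) :
    ∑ i, ((k3HilbertGram 2).map (Int.cast : ℤ → ℂ))⁻¹ i j * k3HilbertForm 2 (Pi.single i 1) v = v j := by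
  classical
  set G : Matrix K3HilbertIndex K3HilbertIndex ℂ := (k3HilbertGram 2).map (Int.cast : ℤ → ℂ) with hG
  have hdet : IsUnit G.det := by
    rw [hG, ← Int.cast_det, k3HilbertGram_two_det, isUnit_iff_ne_zero]; norm_num
  have hGsymm : G.transpose = G := by
    rw [hG, ← Matrix.transpose_map, k3HilbertGram_transpose]
  have hsingle : ∀ (i : K3HilbertIndex), k3HilbertForm 2 (Pi.single i 1) v = G.mulVec v i := fun i => by
    have hq : k3HilbertForm 2 (Pi.single i 1) v = (Pi.single i 1) ⬝ᵥ G.mulVec v := by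
      simp only [k3HilbertForm_apply, dotProduct, Matrix.mulVec, hG, Matrix.map_apply, Finset.mul_sum]
      exact Finset.sum_congr rfl fun i _ => Finset.sum_congr rfl fun j _ => by ring
    rw [hq, single_dotProduct, one_mul]
  simp_rw [hsingle]
  have h : ∑ i, G⁻¹ i j * G.mulVec v i = (G⁻¹.transpose.mulVec (G.mulVec v)) j := by
    simp only [Matrix.mulVec, dotProduct, Matrix.transpose_apply]
  rw [h, Matrix.mulVec_mulVec, Matrix.transpose_nonsing_inv, hGsymm, Matrix.nonsing_inv_mul _ hdet,
    Matrix.one_mulVec]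

/-! ### Graph classes from kappa classes, for arbitrary endomorphisms -/

/-- **The kappa class of ANY endomorphism `g` is a graph class for `g`.** For a marked `X` and a `ℂ`-linear `g`
on `H²(X(ℂ); ℂ)` with `κ_g = Σ (G⁻¹)ᵢⱼ · φ⁻¹eᵢ ∪ g(φ⁻¹eⱼ)` algebraic, there is `t ∈ ℂ` (namely
`Σ (G⁻¹)ᵢⱼ q(eᵢ, g eⱼ) = tr g`) with `(κ_g ∪ y) ∪ w = (t·q(y,w) + q(gy,w) + q(gw,y))·P`: polarised Fujiki
(`cupFour_eq_of_isMarkedK3Hilb`) and the contraction `Σ (G⁻¹)ᵢⱼ q(eᵢ,y) q(g eⱼ,w) = q(g y, w)`, which uses only the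
LINEARITY of `g` (`sum_gramInv_k3HilbertForm_single_eq` and `y = Σ yⱼ eⱼ`) — no bijectivity, no isometry.
[cite: OGrady2008NumericalK3Square, §2.2 Remark 2.1] [cite: Markman2024, §1.1 Thm. 1.1] -/
theorem exists_graphClass_of_kappaClass (hM : MarkedK3Sq[X, φ, P, z])
    (g : complexBetti X 2 →ₗ[ℂ] complexBetti X 2) (hκ : Kap[φ, g] ∈ algebraicClasses X 2) :
    ∃ cg ∈ algebraicClasses X 2, ∃ t : ℂ, ∀ y w : complexBetti X 2,
      Cup3[cg, y, w] = (t * k3HilbertForm 2 (φ y) (φ w) + k3HilbertForm 2 (φ (g y)) (φ w) +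
        k3HilbertForm 2 (φ (g w)) (φ y)) • P := by
  classical
  have hmk : IsMarkedK3Hilb 2 X φ P := isMarkedK3Hilb_of_marked hM
  refine ⟨_, hκ, ∑ i, ∑ j, ((k3HilbertGram 2).map (Int.cast : ℤ → ℂ))⁻¹ i j *
    k3HilbertForm 2 (Pi.single i 1) (φ (g ((LinearEquiv.symm φ) (Pi.single j 1)))), fun y w => ?_⟩
  have hL2 : ∀ (u : ℂ) (A : complexBetti X (2 * 2)), Cup3[u • A, y, w] = u • Cup3[A, y, w] := by
    intro u A; simp only [map_smul, LinearMap.smul_apply]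
  have hL3 : ∀ A : K3HilbertIndex → complexBetti X (2 * 2), Cup3[∑ i, A i, y, w] = ∑ i, Cup3[A i, y, w] := by
    intro A; simp only [map_sum, LinearMap.sum_apply]
  have hvv : ∀ i j, Cup3[cupProduct (rfl : 2 + 2 = 2 * 2) ((LinearEquiv.symm φ) (Pi.single i 1))
      (g ((LinearEquiv.symm φ) (Pi.single j 1))), y, w] =
      (k3HilbertForm 2 (Pi.single i 1) (φ (g ((LinearEquiv.symm φ) (Pi.single j 1)))) *
            k3HilbertForm 2 (φ y) (φ w) +
          k3HilbertForm 2 (Pi.single i 1) (φ y) *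
            k3HilbertForm 2 (φ (g ((LinearEquiv.symm φ) (Pi.single j 1)))) (φ w) +
        k3HilbertForm 2 (Pi.single i 1) (φ w) *
          k3HilbertForm 2 (φ (g ((LinearEquiv.symm φ) (Pi.single j 1)))) (φ y)) • P := by
    intro i j
    have h := (cupFour_def _ _ _ _).symm.trans (cupFour_eq_of_isMarkedK3Hilb hmk
      ((LinearEquiv.symm φ) (Pi.single i 1)) (g ((LinearEquiv.symm φ) (Pi.single j 1))) y w)
    rw [LinearEquiv.apply_symm_apply] at h
    exact h
  -- the linear functional `v ↦ q(φ g φ⁻¹ v, φ w)` and the expansion `φ y = Σ (φ y)ⱼ eⱼ`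
  set qXform : LinearMap.BilinForm ℂ (complexBetti X 2) :=
    (Matrix.toBilin' (Matrix.map (k3HilbertGram 2) (Int.cast : ℤ → ℂ))).compl₁₂
      (φ : complexBetti X 2 →ₗ[ℂ] (K3HilbertIndex → ℂ)) (φ : complexBetti X 2 →ₗ[ℂ] (K3HilbertIndex → ℂ))
    with hqXform
  have hqXapp : ∀ y w, qXform y w = k3HilbertForm 2 (φ y) (φ w) := fun y w => by
    rw [hqXform, LinearMap.compl₁₂_apply, qC_apply]; rfl
  have hlin : ∀ y w : complexBetti X 2,
      ∑ j, (φ y) j * k3HilbertForm 2 (φ (g ((LinearEquiv.symm φ) (Pi.single j 1)))) (φ w) =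
        k3HilbertForm 2 (φ (g y)) (φ w) := by
    intro y w
    set M : (K3HilbertIndex → ℂ) →ₗ[ℂ] complexBetti X 2 →ₗ[ℂ] ℂ :=
      qXform ∘ₗ g ∘ₗ (φ.symm : (K3HilbertIndex → ℂ) →ₗ[ℂ] complexBetti X 2) with hMdef
    have hM : ∀ v, M v w = k3HilbertForm 2 (φ (g ((LinearEquiv.symm φ) v))) (φ w) := fun v => by
      rw [hMdef, LinearMap.comp_apply, LinearMap.comp_apply, hqXapp]
      rfl
    have hexp : (φ y : K3HilbertIndex → ℂ) = ∑ j, (φ y) j • (Pi.single j 1 : K3HilbertIndex → ℂ) := by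
      ext i
      simp [Finset.sum_apply, Pi.single_apply]
    calc ∑ j, (φ y) j * k3HilbertForm 2 (φ (g ((LinearEquiv.symm φ) (Pi.single j 1)))) (φ w)
        = ∑ j, (φ y) j * M (Pi.single j 1) w := Finset.sum_congr rfl fun j _ => by rw [hM]
      _ = M (∑ j, (φ y) j • (Pi.single j 1 : K3HilbertIndex → ℂ)) w := by
          rw [map_sum, LinearMap.sum_apply]
          exact Finset.sum_congr rfl fun j _ => by rw [map_smul, LinearMap.smul_apply, smul_eq_mul]
      _ = k3HilbertForm 2 (φ (g y)) (φ w) := by rw [← hexp, hM, LinearEquiv.symm_apply_apply]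
  -- the key contraction: `Σ (G⁻¹)_{ij} q(eᵢ, y) q(g eⱼ, w) = q(g y, w)`
  have hS : ∀ y w : complexBetti X 2, ∑ i, ∑ j, ((k3HilbertGram 2).map (Int.cast : ℤ → ℂ))⁻¹ i j *
      k3HilbertForm 2 (Pi.single i 1) (φ y) *
        k3HilbertForm 2 (φ (g ((LinearEquiv.symm φ) (Pi.single j 1)))) (φ w) =
      k3HilbertForm 2 (φ (g y)) (φ w) := by
    intro y w
    rw [Finset.sum_comm, ← hlin y w]
    refine Finset.sum_congr rfl fun j _ => ?_
    rw [← sum_gramInv_k3HilbertForm_single_eq (φ y) j, Finset.sum_mul]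
  rw [hL3]
  simp_rw [hL3, hL2, hvv, smul_smul, ← Finset.sum_smul]
  congr 1
  simp only [mul_add, Finset.sum_add_distrib]
  rw [← hS y w, ← hS w y, Finset.sum_mul]
  congr 1
  · congr 1
    · refine Finset.sum_congr rfl fun i _ => ?_
      rw [Finset.sum_mul]
      exact Finset.sum_congr rfl fun j _ => by ring
    · exact Finset.sum_congr rfl fun i _ => Finset.sum_congr rfl fun j _ => by ring
  · exact Finset.sum_congr rfl fun i _ => Finset.sum_congr rfl fun j _ => by ring

/-! ### Kappa classes of cycle-induced endomorphisms are algebraic (granted `Q_X` algebraic) -/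

/-- **`κ_g ∈ A²(X)` for `g = [Z]_*` with `Z ∈ A⁴(X × X)`**, for a marked smooth projective `K3^{[2]}`-type `X`,
granted F-QX (`QInvAlgebraic`: `Q_X ∈ A²(X × X)`) and the multiplicativity of algebraic classes: `κ_g =
pr_{1*}(Q_X ∪ Z)` (`kappaClass_eq_complexGysin_qInvClass_cup`, gen 10), `Q_X ∪ Z ∈ A⁶(X × X)` (`hcup`), and the
Gysin push-forward preserves algebraic classes (`complexGysin_mem_supportedClasses`). Any orientation family
`μ` with Poincaré duality. [cite: VoisinHodgeII2003, §9.2.4 Prop. 9.20 and proof of Thm. 10.17 (10.7)]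
[cite: CharlesMarkman2013, Thm. 1.1 (§1)] -/
theorem kappaClass_mem_algebraicClasses_of_corrAction (hQ : QInvAlgebraic)
    (hcup : Voisin2003_cupProduct_algebraicClasses) {μ : OrientationFamily} (hμ : μ.HasPoincareDuality)
    (hX : IsSmoothProjective 4 X) (hK : IsOfK3HilbertSquareType X) (hM : MarkedK3Sq[X, φ, P, z])
    {Z : complexBetti (X ⊗ X) (2 * 4)} (hZ : Z ∈ algebraicClasses (X ⊗ X) 4)
    (g : complexBetti X 2 →ₗ[ℂ] complexBetti X 2)
    (hg : ∀ x : complexBetti X 2, g x = corrAction μ hX hX (rfl : 2 + 2 * 4 = 2 + 2 * 4) Z x) :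
    Kap[φ, g] ∈ algebraicClasses X 2 := by
  classical
  rw [kappaClass_eq_complexGysin_qInvClass_cup hμ hX φ Z g hg]
  have hXX : IsSmoothProjective (4 + 4) (X ⊗ X) := IsSmoothProjective.tensor_holds hX hX
  have hQZ : cupProduct (two_mul_add_two_mul 2 4) (qInvClass φ) Z ∈ algebraicClasses (X ⊗ X) (2 + 4) :=
    hcup hXX (hQ X hX hK φ P z hM) hZ
  exact complexGysin_mem_supportedClasses (gysinMap_restrictCompl_eq_zero_of_field ℂ) μ hμ
    (IsSmoothProjective.tensor_holds hX hX) hX (fst X X) _ (r := 2 + 4) (s := 2) (by norm_num) hQZ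

end Summit.HodgeConjecture.HodgeConjecture.Theorems.MarkmanPartnerTransport.PartnerLattice
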